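import Literature.MathematicalPhysics.QuantumFieldTheory.Balaban1983to89.B14Eq216Concrete
import Literature.MathematicalPhysics.QuantumFieldTheory.Balaban1983to89.B10Eq42TorusConstraint
import Literature.MathematicalPhysics.QuantumFieldTheory.Balaban1983to89.Node00.MultiScaleFibreChart

/-!
# `Balaban1983to89.B15Prop1TowerFlatOfNearFlat` — [Balaban1988Convergent] = «[III]», (1.3) p. 246, (2.2) p. 255, (2.10)–(2.13) pp. 256–257; [Balaban1989LargeFieldI] = «[IV]», (1.74) p. 192;
# [Balaban1985Averaging] = «[4]», (124) p. 36:
# THE TOWER-FLATNESS GAUGE ROW (δ_T) OF THE (J0′) PRODUCER IS REDUNDANT — it follows from the `Ω₁`-FLATNESS ROW (δ), the LEVEL-0 CONSTRAINT `U₀ = Q_k^{s*}V` on `Γ₀ = Ω₁ᶜ`, and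
# the block geometry of the determining set `𝐁_k(Z)`

Honest framing: statement-level skeleton of published theorems with citation tags; proofs where landed; nothing here is a claim about the
Yang–Mills mass gap.  Cell `pub-ymgap`, HUMAN RULING D-0062 (Track A), seat `pub-ymgap-dag-n12-c` g26 (lane owner N12 = [B15], strategy s1); count-neutral; N12 NOT discharged;
finite 𝕋⁴ at fixed ε; nothing continuum ∕ OS ∕ mass-gap ∕ Clay.

WHY (lane memo `N12-UNIFORMITY-SPEC.md` §8 addendum 10:58Z).  The (J0′) producer of record with the (β) row split (dag-n12-c g25, `…N12MinimiserFamilyOfClassGaugeRows`) displays per base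
field TWO gauge letters on the (2.12)-minimiser `U₀`: (δ) `‖U₀(b) − 1‖ ≤ δc` on the four bonds of every plaquette meeting a bond sourced in `Ω₁(Z)`, and (δ_T) `‖U₀(b) − 1‖ ≤ δT` on
every fine bond `b` of the tower region `blockIter j ⁻¹' {c₋, c₊}` of every POSITIVE-level constrained bond `(j, c)` of `𝐁_k(Z)` (the linearised averaging at `c` transports along contours
through the whole tower box, [4] (124)).  THIS FILE proves (δ_T) ⟸ (δ) with `δT := δc`, for ANY averaging family, ANY base `W` and `SU(N)`:
 • the `Γ_j` end `y₀` of `c` (`c ∈ bondsOf (𝐁_k(Z) j)`, `Γ_j ⊆ Ω_j^{(j)}`) has its whole `j`-block inside `Ω_j(Z) ⊆ Ω₁(Z)` — `Ω_j(Z)` is a union of `j`-blocks ([III] (2.13),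
   `B14.Eq213DetSet.isBlockUnion_maxDomT`);
 • a tower bond with its source OR its target in `Ω₁(Z)` is one of the four bonds of a plaquette meeting an `Ω₁`-sourced bond (`d ≥ 2`), so (δ) bounds it;
 • a tower bond with BOTH ends off `Ω₁(Z)` has both ends in the other end's `j`-block (the `Γ_j` end's block lies in `Ω₁`), hence in one `k`-block, so the pull-back datum is `1`
   there ([III] (1.3), `B14.Eq216Concrete.qsstarGIter0_of_interior`), and the bond meets `Γ₀ = Ω₁ᶜ = 𝐁_k(Z)_0` ([III] (2.2), `Bj_zero`), where the constraint (2.10)–(2.12) pins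
   `U₀(b) = (Q_k^{s*}W)(b) = 1`.
So per base field the producer needs ONE gauge row, not two.

CONTENTS (theorems only; no `def`, no `instance`, no `sorry`).  §1 `blockIter_eq_of_blockIter_eq_of_le`, `mem_maxDomT_of_blockIter_eq_of_mem_Bj` ∕ `mem_maxDomT_one_of_blockIter_eq_of_mem_Bj`
(the `Γ_j` end's block), `exists_plaq_src_eq` (the plaquette device); §2 ★★ `norm_sub_one_le_towerBond_of_nearFlat_of_agreeOn` (per tower bond); §3 ★★★
`towerNearFlat_of_nearFlat_of_agreeOn_constr` (`Node00.constrEnum` currency: the producer's (δ_T) row VERBATIM with `δT := δc`, from its (δ) row VERBATIM + the constraint).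
HONEST SCOPE: block bookkeeping; (δ) itself remains a GAUGE letter (holonomy obstruction, lane memo LOCATED-GEOM v3); nothing of Bałaban's estimates asserted; count-neutral; N12 NOT
discharged; the YM mass gap (Clay) is NOT proved by any of this — R4 closes only the conditional finite-𝕋⁴ rung `BalabanLadder.UV`.
-/

noncomputable section

namespace Literature.MathematicalPhysics.QuantumFieldTheory.Balaban1983to89.B15Prop1TowerFlatOfNearFlat

open Literature.MathematicalPhysics.QuantumFieldTheory.Balaban1983to89.Node00 (SU ConstrSet constrCard constrEnum)
open B15DeterminingSets
open B14.Eq213MaximalDomains (side)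
open B14.Eq213DetSet (Bj Bj_zero Bj_mid Bj_top maxDomT maxDomT_antitone isBlockUnion_maxDomT)
open B14.Eq22Determines (blockIter blockIter_succ IsBlockUnion)
open B14.Eq216Concrete (qsstarGIter0_of_interior)
open B10Eq42TorusConstraint (bondsIn mem_bondsIn_iff)
open Literature.MathematicalPhysics.QuantumFieldTheory.BalabanImbrieJaffe1984to88.BIJ85Eq453GaugeField (qsstarGIter0)
open scoped Matrix.Norms.L2Operator

variable {P : Params}

/-! ## §1  Block bookkeeping -/

/-- Two fine sites in one `j`-block lie in one `k`-block for every `k ≥ j` (`blockIter (n+1) = blockOf ∘ blockIter n`). [cite: Balaban1987RG1, (0.1) p.251 (bookkeeping)] -/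
theorem blockIter_eq_of_blockIter_eq_of_le {j k : ℕ} (hjk : j ≤ k) {a a' : Site P 0} (h : blockIter j a = blockIter j a') :
    blockIter k a = blockIter k a' := by
  obtain ⟨t, rfl⟩ := Nat.exists_eq_add_of_le hjk
  clear hjk
  induction t with
  | zero => simpa using h
  | succ t ih =>
    show blockIter (j + t + 1) a = blockIter (j + t + 1) a'
    rw [blockIter_succ, blockIter_succ, ih]

/-- **The `Γ_j` end's `j`-block lies in `Ω_j(Z)`**: for `1 ≤ j ≤ k ≤ m + K`, `s_k ∣ 2L^{m+K}`, a scale-`j` site `y₀ ∈ 𝐁_k(Z)_j` (`⊆ Ω_j(Z)^{(j)}`) and a fine site `x` with `B^j(x) = y₀`: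
`x ∈ Ω_j(Z)` — `Ω_j(Z)` is a union of `j`-blocks, membership decided by the representative `ι_j y₀ ∈ Ω_j(Z)`. [cite: Balaban1988Convergent, (2.2) p.255, (2.13) pp.256–257] -/
theorem mem_maxDomT_of_blockIter_eq_of_mem_Bj {M₁ : ℕ} (hM : 1 ≤ M₁) (Z : Set (Site P 0)) {k : ℕ} (hk : k ≤ P.m + P.K)
    (hdiv : side P.L M₁ k ∣ P.sitesPerDir 0) {j : ℕ} (hj1 : 1 ≤ j) (hjk : j ≤ k) {y₀ : Site P j} (hy₀ : y₀ ∈ Bj M₁ Z k j)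
    {x : Site P 0} (hx : blockIter j x = y₀) : x ∈ maxDomT M₁ Z j := by
  have hsub : Bj M₁ Z k j ⊆ pts j (maxDomT M₁ Z j) := by
    rcases lt_or_eq_of_le hjk with hlt | rfl
    · rw [Bj_mid hj1 hlt]; exact fun _ h => h.1
    · rw [Bj_top]
  have h1 : embIter j y₀ ∈ maxDomT M₁ Z j := mem_pts.1 (hsub hy₀)
  have hBU : IsBlockUnion j (maxDomT M₁ Z j) := isBlockUnion_maxDomT hM hdiv hj1 hjk (hjk.trans hk)
  exact (hBU x).2 (by rw [hx]; exact h1)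

/-- Hence the `Γ_j` end's `j`-block lies in `Ω₁(Z)` (`Ω_j ⊆ Ω₁`, `1 ≤ j`). [cite: Balaban1988Convergent, (2.13) pp.256–257] -/
theorem mem_maxDomT_one_of_blockIter_eq_of_mem_Bj {M₁ : ℕ} (hM : 1 ≤ M₁) (Z : Set (Site P 0)) {k : ℕ} (hk : k ≤ P.m + P.K)
    (hdiv : side P.L M₁ k ∣ P.sitesPerDir 0) {j : ℕ} (hj1 : 1 ≤ j) (hjk : j ≤ k) {y₀ : Site P j} (hy₀ : y₀ ∈ Bj M₁ Z k j)
    {x : Site P 0} (hx : blockIter j x = y₀) : x ∈ maxDomT M₁ Z 1 :=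
  maxDomT_antitone hM Z hj1 (mem_maxDomT_of_blockIter_eq_of_mem_Bj hM Z hk hdiv hj1 hjk hy₀ hx)

/-- The plaquette device (`d ≥ 2`): every bond direction `μ` has a companion `ν ≠ μ`, so every site `x` carries a positively oriented plaquette with corner `x` one of whose two
`x`-sourced bonds points in direction `μ`. [cite: Balaban1985Averaging, (5) p.18 (bookkeeping)] -/
theorem exists_plaq_src_eq (hd : 2 ≤ P.d) {i : ℕ} (x : Site P i) (μ : Fin P.d) :
    ∃ q : Plaq P i, q.src = x ∧ (q.μ = μ ∨ q.ν = μ) := by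
  by_cases h0 : μ.val = 0
  · refine ⟨⟨x, μ, ⟨1, by omega⟩, ?_⟩, rfl, Or.inl rfl⟩
    show μ.val < 1
    omega
  · refine ⟨⟨x, ⟨0, by omega⟩, μ, ?_⟩, rfl, Or.inr rfl⟩
    show (0 : ℕ) < μ.val
    omega

/-! ## §2  Per tower bond: (δ_T) ⟸ (δ) + the level-0 constraint -/

/-- ★★ **A TOWER BOND OF A POSITIVE-LEVEL CONSTRAINED BOND IS `δc`-FLAT, given the `Ω₁`-flatness row (δ) and the constraint.**  Objects: a domain `Z ⊂ T_η`, `M₁ ≥ 1`, the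
determining set `𝐁_k(Z)` (`0 < k ≤ m + K`, `s_k ∣ 2L^{m+K}`), ANY averaging family `av`, ANY scale-`k` base `W`, a configuration `U₀` with `M˙(U₀) = M˙(Q_k^{s*}W)` on `𝐁_k(Z)` ([III]
(2.10)–(2.12)), and the row (δ): the four bonds of every plaquette meeting a bond sourced in `Ω₁(Z)` are `δc`-flat for `U₀` (`0 ≤ δc`, `d ≥ 2`).  CONCLUSION: for `1 ≤ j ≤ k`, `c ∈
bondsOf (𝐁_k(Z) j)` and every fine bond `b` of the tower region `blockIter j ⁻¹' {c₋, c₊}`, `‖U₀(b) − 1‖ ≤ δc`.  Proof: `b₋ ∈ Ω₁` or `b₊ ∈ Ω₁` ⇒ (δ) at a plaquette through `b`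
(`exists_plaq_src_eq`); both off `Ω₁` ⇒ both in the non-`Γ_j` end's `j`-block (§1) ⇒ one `k`-block ⇒ `(Q_k^{s*}W)(b) = 1` ([III] (1.3), `qsstarGIter0_of_interior`) and `b ∈ bondsOf(Γ₀)`,
`Γ₀ = Ω₁ᶜ` (`Bj_zero`) ⇒ the scale-`0` constraint reads `U₀(b) = 1`.
[cite: Balaban1988Convergent, (1.3) p.246, (2.2) p.255, (2.10)–(2.13) pp.256–257; Balaban1989LargeFieldI, (1.74) p.192; Balaban1985Averaging, (124) p.36] -/
theorem norm_sub_one_le_towerBond_of_nearFlat_of_agreeOn {N : ℕ} [NeZero N] {M₁ : ℕ} (hM : 1 ≤ M₁) (hd : 2 ≤ P.d)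
    (Z : Set (Site P 0)) {k : ℕ} (hk0 : 0 < k) (hk : k ≤ P.m + P.K) (hdiv : side P.L M₁ k ∣ P.sitesPerDir 0)
    (av : ∀ j, Averaging P j (SU N)) (W : GaugeField P k (SU N)) {U₀ : GaugeField P 0 (SU N)}
    (hagree : AgreeOn (Bj M₁ Z k) (avgFamily av U₀) (avgFamily av (qsstarGIter0 k W)))
    {δc : ℝ} (hδc : 0 ≤ δc)
    (hNF : ∀ q : Plaq P 0, ((⟨q.src, q.μ⟩ : PBond P 0) ∈ {b : PBond P 0 | b.src ∈ maxDomT M₁ Z 1} ∨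
        (⟨q.src.shift q.μ, q.ν⟩ : PBond P 0) ∈ {b : PBond P 0 | b.src ∈ maxDomT M₁ Z 1} ∨
        (⟨q.src.shift q.ν, q.μ⟩ : PBond P 0) ∈ {b : PBond P 0 | b.src ∈ maxDomT M₁ Z 1} ∨
        (⟨q.src, q.ν⟩ : PBond P 0) ∈ {b : PBond P 0 | b.src ∈ maxDomT M₁ Z 1}) →
      ‖((U₀ ⟨q.src, q.μ⟩ : SU N) : Matrix (Fin N) (Fin N) ℂ) - 1‖ ≤ δc ∧ ‖((U₀ ⟨q.src.shift q.μ, q.ν⟩ : SU N) : Matrix (Fin N) (Fin N) ℂ) - 1‖ ≤ δc ∧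
        ‖((U₀ ⟨q.src.shift q.ν, q.μ⟩ : SU N) : Matrix (Fin N) (Fin N) ℂ) - 1‖ ≤ δc ∧ ‖((U₀ ⟨q.src, q.ν⟩ : SU N) : Matrix (Fin N) (Fin N) ℂ) - 1‖ ≤ δc)
    {j : ℕ} (hj1 : 1 ≤ j) (hjk : j ≤ k) {c : PBond P j} (hc : c ∈ bondsOf (Bj M₁ Z k j))
    {b : PBond P 0} (hb : b ∈ bondsIn 0 (blockIter j ⁻¹' ({c.src, c.tgt} : Set (Site P j)))) :
    ‖((U₀ b : SU N) : Matrix (Fin N) (Fin N) ℂ) - 1‖ ≤ δc := by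
  obtain ⟨x, μ⟩ := b
  -- the tower region membership, read at scale `0` (`toFine 0 = id`)
  have hb' := (mem_bondsIn_iff.1 hb)
  simp only [B10Eq38TorusDomains.toFine_zero, Set.mem_preimage, Set.mem_insert_iff, Set.mem_singleton_iff] at hb'
  obtain ⟨hsrc, htgt⟩ := hb'
  -- a plaquette through `b`
  obtain ⟨q, hqx, hqμ⟩ := exists_plaq_src_eq hd x μ
  by_cases hs : x ∈ maxDomT M₁ Z 1
  · -- `b₋ ∈ Ω₁`: `b` itself is an `Ω₁`-sourced bond of `q`
    rcases hqμ with hqμ | hqν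
    · have h := (hNF q (Or.inl (by rw [Set.mem_setOf_eq, hqx]; exact hs))).1
      rwa [hqx, hqμ] at h
    · have h := (hNF q (Or.inr (Or.inr (Or.inr (by rw [Set.mem_setOf_eq, hqx]; exact hs))))).2.2.2
      rwa [hqx, hqν] at h
  by_cases ht : x.shift μ ∈ maxDomT M₁ Z 1
  · -- `b₊ ∈ Ω₁`: the bond of `q` leaving `b₊` is `Ω₁`-sourced
    rcases hqμ with hqμ | hqν
    · have h := (hNF q (Or.inr (Or.inl (by rw [Set.mem_setOf_eq, hqx, hqμ]; exact ht)))).1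
      rwa [hqx, hqμ] at h
    · have h := (hNF q (Or.inr (Or.inr (Or.inl (by rw [Set.mem_setOf_eq, hqx, hqν]; exact ht))))).2.2.2
      rwa [hqx, hqν] at h
  -- both ends off `Ω₁`: they lie in the non-`Γ_j` end's `j`-block, hence in one `k`-block
  have key : ∀ {y₀ : Site P j}, y₀ ∈ Bj M₁ Z k j → ∀ z : Site P 0, blockIter j z = y₀ → z ∈ maxDomT M₁ Z 1 :=
    fun hy₀ z hz => mem_maxDomT_one_of_blockIter_eq_of_mem_Bj hM Z hk hdiv hj1 hjk hy₀ hz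
  have hblk : blockIter j x = blockIter j (x.shift μ) := by
    rcases hc with hc | hc
    · have hs' : blockIter j x = c.tgt := hsrc.resolve_left fun h => hs (key hc _ h)
      have ht' : blockIter j (x.shift μ) = c.tgt := htgt.resolve_left fun h => ht (key hc _ h)
      rw [hs', ht']
    · have hs' : blockIter j x = c.src := hsrc.resolve_right fun h => hs (key hc _ h)
      have ht' : blockIter j (x.shift μ) = c.src := htgt.resolve_right fun h => ht (key hc _ h)
      rw [hs', ht']
  have hblkk : blockIter k (⟨x, μ⟩ : PBond P 0).src = blockIter k (⟨x, μ⟩ : PBond P 0).tgt :=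
    blockIter_eq_of_blockIter_eq_of_le hjk hblk
  have hQ : qsstarGIter0 k W ⟨x, μ⟩ = 1 := qsstarGIter0_of_interior hk W hblkk
  -- the scale-`0` constraint on `Γ₀ = Ω₁ᶜ`
  have hb0 : (⟨x, μ⟩ : PBond P 0) ∈ bondsOf (Bj M₁ Z k 0) := by
    rw [Bj_zero hk0]
    exact Or.inl hs
  have hU : U₀ ⟨x, μ⟩ = qsstarGIter0 k W ⟨x, μ⟩ := hagree 0 _ hb0
  rw [hU, hQ]
  simpa using hδc

/-! ## §3  Enumerated: the producer's (δ_T) row from its (δ) row -/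

/-- ★★★ **THE TOWER-FLATNESS ROW (δ_T) FROM THE `Ω₁`-FLATNESS ROW (δ) AND THE CONSTRAINT, ENUMERATED** (`Node00.constrEnum` currency, the index of the datum coordinates): under the
objects and rows of §2, for every `i : Fin (constrCard (𝐁_k(Z)) k)` of POSITIVE level `j_i` and every fine bond `b` of the tower region `blockIter j_i ⁻¹' {(c_i)₋, (c_i)₊}`,
`‖U₀(b) − 1‖ ≤ δc` — the (J0′) producer's (δ_T) row (dag-n12-c g25 `…N12MinimiserFamilyOfClassGaugeRows`) VERBATIM with `δT := δc`.
[cite: Balaban1988Convergent, (1.3) p.246, (2.2) p.255, (2.10)–(2.13) pp.256–257; Balaban1989LargeFieldI, (1.74) p.192; Balaban1985Averaging, (124) p.36] -/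
theorem towerNearFlat_of_nearFlat_of_agreeOn_constr {N : ℕ} [NeZero N] {M₁ : ℕ} (hM : 1 ≤ M₁) (hd : 2 ≤ P.d)
    (Z : Set (Site P 0)) {k : ℕ} (hk0 : 0 < k) (hk : k ≤ P.m + P.K) (hdiv : side P.L M₁ k ∣ P.sitesPerDir 0)
    (av : ∀ j, Averaging P j (SU N)) (W : GaugeField P k (SU N)) {U₀ : GaugeField P 0 (SU N)}
    (hagree : AgreeOn (Bj M₁ Z k) (avgFamily av U₀) (avgFamily av (qsstarGIter0 k W)))
    {δc : ℝ} (hδc : 0 ≤ δc)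
    (hNF : ∀ q : Plaq P 0, ((⟨q.src, q.μ⟩ : PBond P 0) ∈ {b : PBond P 0 | b.src ∈ maxDomT M₁ Z 1} ∨
        (⟨q.src.shift q.μ, q.ν⟩ : PBond P 0) ∈ {b : PBond P 0 | b.src ∈ maxDomT M₁ Z 1} ∨
        (⟨q.src.shift q.ν, q.μ⟩ : PBond P 0) ∈ {b : PBond P 0 | b.src ∈ maxDomT M₁ Z 1} ∨
        (⟨q.src, q.ν⟩ : PBond P 0) ∈ {b : PBond P 0 | b.src ∈ maxDomT M₁ Z 1}) →
      ‖((U₀ ⟨q.src, q.μ⟩ : SU N) : Matrix (Fin N) (Fin N) ℂ) - 1‖ ≤ δc ∧ ‖((U₀ ⟨q.src.shift q.μ, q.ν⟩ : SU N) : Matrix (Fin N) (Fin N) ℂ) - 1‖ ≤ δc ∧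
        ‖((U₀ ⟨q.src.shift q.ν, q.μ⟩ : SU N) : Matrix (Fin N) (Fin N) ℂ) - 1‖ ≤ δc ∧ ‖((U₀ ⟨q.src, q.ν⟩ : SU N) : Matrix (Fin N) (Fin N) ℂ) - 1‖ ≤ δc) :
    ∀ i : Fin (constrCard (Bj M₁ Z k) k), 0 < (((constrEnum (Bj M₁ Z k) k).symm i).1 : ℕ) →
      ∀ b : PBond P 0, b ∈ bondsIn 0 (blockIter (((constrEnum (Bj M₁ Z k) k).symm i).1 : ℕ) ⁻¹'
        ({((constrEnum (Bj M₁ Z k) k).symm i).2.1.src, ((constrEnum (Bj M₁ Z k) k).symm i).2.1.tgt} :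
          Set (Site P ((constrEnum (Bj M₁ Z k) k).symm i).1))) →
        ‖((U₀ b : SU N) : Matrix (Fin N) (Fin N) ℂ) - 1‖ ≤ δc := by
  intro i hi b hb
  exact norm_sub_one_le_towerBond_of_nearFlat_of_agreeOn hM hd Z hk0 hk hdiv av W hagree hδc hNF hi
    (Nat.lt_succ_iff.1 ((constrEnum (Bj M₁ Z k) k).symm i).1.2) ((constrEnum (Bj M₁ Z k) k).symm i).2.2 hb

end Literature.MathematicalPhysics.QuantumFieldTheory.Balaban1983to89.B15Prop1TowerFlatOfNearFlat

end
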